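import Summits.NavierStokesRegularity.NavierStokesRegularity.Theorems.CircuitPump.Negative.CriticalBound
import Summits.NavierStokesRegularity.NavierStokesRegularity.Theorems.WakeRatchetEternalViscousRateCircuitPumpKill

/-!
# `WakeRatchet.EternalViscousRate` (stmt-NavierStokesRegularity-25647): (hbd) DISCHARGED — every perpetual-pump witness
# refutes the inner rate statement at its own scale ratio, unconditionally (brick M2 of the bridge)

`CircuitPumpNegative.typeI_critical_bound` (Type I ⟹ `lam^{n/5}|X_{i,n}| ≤ C'`, cdisprove seat of `PerpetualPump.CircuitPump`)
gives the boundedness of every shell vector near the blow-up time (`shellBound_of_typeI`), i.e. the last hypothesis (hbd) of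
`WakeRatchetCircuitPumpKill.not_rateContraction_of_pumpWitness`; hence `not_rateContraction_of_pumpWitness'`: for ANY witness
of the clauses of `PerpetualPump.CircuitPump` (period 1) the renormalised family at `ε₀ = lam^{2/5} - 1` is an admissible
eternal solution with covariant viscosity `1` of the pulled-back table, uniformly bounded, along which the conclusion of
`EternalViscousRate` fails for EVERY `a > 1`.  What separates this from the Negative lemma «no spread-uniform threshold for
⟨25647⟩» is only the re-export of the tree's m = 2 Toda witness with its explicit table (proof of
`PerpetualPumpCircuitPump.stub_clockBox`, statement hides `m`/`coeff`) and the `Fin 4` padding (`…CircuitPumpPad`,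
`…CircuitPumpPadClass`, `…CircuitPumpTodaClass`).  (At submission the module `CircuitPump.Negative.CriticalBound` had no
olean on the farm; the content of this file was validated against an inlined copy of that module.)
HONEST LABEL: MODEL lattice ODEs only (Tao 2016 §4, §6.4); no item is closed or refuted; nothing here bears on the
Navier–Stokes equations.
-/

set_option linter.dupNamespace false

noncomputable section

open scoped BigOperators
open Real Set Filter Topology MeasureTheory

/-! ## M2: boundedness near the blow-up time from the critical bound -/

namespace Summit.NavierStokesRegularity.NavierStokesRegularity.Theorems.WakeRatchetCircuitPumpBdd

open Summit.NavierStokesRegularity.NavierStokesRegularity.Theorems.CircuitPumpNegative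
open Summit.NavierStokesRegularity.NavierStokesRegularity.Theorems.WakeRatchetCircuitPumpAction
open Summit.NavierStokesRegularity.NavierStokesRegularity.Theorems.WakeRatchetCircuitPumpKill
open Literature.Analysis.FluidPDE Literature.Analysis.FluidPDE.TaoCascade

variable {m : ℕ}

/-- **(hbd) for Type-I circuit solutions.**  By `CircuitPumpNegative.typeI_critical_bound` (`lam^{n/5}|X_{i,n}(t)| ≤ C'`)
every shell vector of a Type-I solution of a viscous Tao circuit on `(-∞,0)` is bounded on the whole past, in particular on
`[-1/2, 0)`: the hypothesis (hbd) of `WakeRatchetCircuitPumpAssembly.viscousBlockDSS_of_pumpWitness` /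
`WakeRatchetCircuitPumpKill.not_rateContraction_of_pumpWitness`.
[cite: Tao2016AveragedNS, §4, the viscous equation before Thm. 4.2, §6.4; cell vocabulary] -/
theorem shellBound_of_typeI {lam : ℝ} (hlam : 1 < lam)
    (coeff : Fin m → Fin m → Fin m → Option (Fin 3) → ℝ) (X : Fin m → ℤ → ℝ → ℝ)
    (hode : SolvesODE lam coeff X) (hTI : IsTypeI lam X) :
    ∀ n : ℤ, ∃ P : ℝ, ∀ t : ℝ, -(1 / 2) ≤ t → t < 0 → ‖shellVec X n t‖ ≤ P := by
  obtain ⟨C', hC'⟩ := typeI_critical_bound hlam coeff X hode hTI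
  have hpos : 0 < lam := by linarith
  intro n
  refine ⟨(m : ℝ) * (C' * lam ^ (-((1 / 5 : ℝ) * n))), fun t _ ht => ?_⟩
  have hw : 0 < lam ^ ((1 / 5 : ℝ) * n) := Real.rpow_pos_of_pos hpos _
  have hcomp : ∀ j : Fin m, |X j n t| ≤ C' * lam ^ (-((1 / 5 : ℝ) * n)) := by
    intro j
    have h := hC' j n t ht
    rw [Real.rpow_neg hpos.le, ← div_eq_mul_inv, le_div_iff₀ hw]
    linarith [mul_comm (lam ^ ((1 / 5 : ℝ) * n)) (|X j n t|)]
  calc ‖shellVec X n t‖ ≤ ∑ j : Fin m, |X j n t| := norm_shellVec_le_sum X n t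
    _ ≤ ∑ _j : Fin m, C' * lam ^ (-((1 / 5 : ℝ) * n)) := Finset.sum_le_sum fun j _ => hcomp j
    _ = (m : ℝ) * (C' * lam ^ (-((1 / 5 : ℝ) * n))) := by simp

/-- **A perpetual-pump witness refutes the inner rate statement of `EternalViscousRate` at its own scale ratio, for every
`a > 1` — UNCONDITIONALLY in the witness** (the (hbd) input of `…CircuitPumpKill.not_rateContraction_of_pumpWitness`
discharged by `shellBound_of_typeI`).  For ANY cyclic-cancelling table `coeff` and ANY solution `X` of the viscous circuit on
`(-∞,0)` that is exactly self-similar with period 1, Type I and non-trivial (the clauses of `PerpetualPump.CircuitPump`,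
PROVED to be inhabited at every fine `lam` by `PerpetualPumpCircuitPump.CircuitPump_proof`): at `ε₀ = lam^{2/5} - 1` the
renormalised family is an admissible eternal solution with covariant viscosity `1` of the pulled-back Tao-class table,
uniformly bounded, and the tail-envelope contraction by `(1+ε₀)^{-a}` FAILS for every `a > 1`.
[cite: Tao2016AveragedNS, §4 Thm. 4.2 (statement shape), the viscous equation before it, §6.4; cell vocabulary (stmt-NavierStokesRegularity-25647)] -/
theorem not_rateContraction_of_pumpWitness' {lam : ℝ} (hlam : 1 < lam)
    (coeff : Fin m → Fin m → Fin m → Option (Fin 3) → ℝ) (hcyc : IsCyc coeff) (X : Fin m → ℤ → ℝ → ℝ)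
    (hode : SolvesODE lam coeff X) (hdss : IsDSS lam 1 X) (hTI : IsTypeI lam X) (hnt : IsNontrivial X)
    {a : ℝ} (ha : 1 < a) :
    ∃ (ε₀ : ℝ) (W : ℤ → ℝ → Em m), 0 < ε₀ ∧ (1 + ε₀) ^ ((5 : ℝ) / 2) = lam ∧
      IsEternalVisc ε₀ 1 (fun (i₁ i₂ i₃ : Fin m) (μ : ℤ × ℤ × ℤ) =>
        if μ = (0, 0, 0) then coeff i₁ i₂ i₃ none
        else if μ = (1, 0, 0) then coeff i₁ i₂ i₃ (some 0)
        else if μ = (0, 1, 0) then coeff i₁ i₂ i₃ (some 1)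
        else if μ = (0, 0, 1) then coeff i₁ i₂ i₃ (some 2) else 0) W ∧
      UniformBound W ∧
      ¬ ∀ (n : ℤ) (M : ℝ), (∀ σ : ℝ, ∑' k : ℕ, physEnergy ε₀ W (n + k) σ ≤ M) →
          ∀ σ : ℝ, ∑' k : ℕ, physEnergy ε₀ W (n + 1 + k) σ ≤ (1 + ε₀) ^ (-a) * M :=
  not_rateContraction_of_pumpWitness hlam coeff hcyc X hode hdss hTI hnt (shellBound_of_typeI hlam coeff X hode hTI) ha

end Summit.NavierStokesRegularity.NavierStokesRegularity.Theorems.WakeRatchetCircuitPumpBdd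

end
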